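import Mathlib.GroupTheory.FreeGroup.CyclicallyReduced
import Mathlib.Data.List.Rotate
import Literature.GroupTheory.CombinatorialGroupTheory.NielsenCancellation
import HarnessLib

/-!
# Power words in free groups: periodic words, cyclic reduction, and Baumslag's stabilisation

Topic `Literature/GroupTheory/CombinatorialGroupTheory`; theorems only, over Mathlib's reduction
theory of free groups (`FreeGroup.reduce/toWord`, `FreeGroup.IsCyclicallyReduced`) and the tree's
cancellation calculus `NielsenCancellation.lean` (`maxCancel`, `reduce_append_eq`,
`toWord_mul_eq`).  This is part I of the formalisation of G. Baumslag's *big powers lemma*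
(G. Baumslag, *On generalised free products*, Math. Z. 78 (1962) 423–438, Prop. 1:
free groups have the big powers property), files `FreeGroupBigPowersCore.lean` (II) and
`FreeGroupBigPowers.lean` (III).

Contents (`V = v.toWord` cyclically reduced, `Vⁿ = (replicate n V).flatten`):
* periodic words — `take/drop` of whole periods, a prefix `V^q ++ V.take r`, and a window of one
  period length is a ROTATION of the period (`take_drop_flatten_replicate`);
* `mk_rotate` (a rotation of a word is the conjugate by its prefix), `eq_one_of_conj_eq_inv`
  (in a free group only `1` is conjugate to its inverse — from `IsMulTorsionFree`),
  `commute_mk_take_of_rotate_eq`;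
* `toWord_pow_of_isCyclicallyReduced` (`(vⁿ).toWord = Vⁿ`), `isCyclicallyReduced_invRev`;
* **stabilisation** (Lyndon–Schupp I §2, the bounded cancellation behind Baumslag's lemma):
  `exists_pow_mul_toWord_eq_append` — some `vᵃ h` is spelled `V ++ W` (the cancellation of `h`
  against powers of `v` is exhausted after finitely many copies); `toWord_pow_mul_of_prefix` —
  then further copies of `v` just prepend `V` ("pumping"); packaged as `exists_left_stable` /
  `exists_right_stable`.

## References
* G. Baumslag, *On generalised free products*, Math. Z. 78 (1962) 423–438. [Baumslag1962]
* R. C. Lyndon, P. E. Schupp, *Combinatorial Group Theory* (1977/2001), Ch. I §2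
  (cancellation in products of reduced words; Prop. 2.15). [LyndonSchupp2001]
-/

namespace Literature.GroupTheory.CombinatorialGroupTheory

open List

universe u

namespace FreeGroupBigPowers

variable {α : Type u}

/-! ### Periodic words `Lⁿ = (replicate n L).flatten` -/

/-- `invRev` of a power word is the power word of `invRev`. [cite: LyndonSchupp2001, Ch. I §2] -/
theorem invRev_flatten_replicate (L : List (α × Bool)) (n : ℕ) :
    FreeGroup.invRev (replicate n L).flatten = (replicate n (FreeGroup.invRev L)).flatten := by
  induction n with
  | zero => simp [FreeGroup.invRev]
  | succ n ih =>
    rw [replicate_succ, flatten_cons, FreeGroup.invRev_append, ih, replicate_succ', flatten_concat]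

/-- The reverse of a power word is the power word of the reverse. [cite: LyndonSchupp2001, Ch. I §2] -/
theorem reverse_flatten_replicate {β : Type*} (L : List β) (n : ℕ) :
    ((replicate n L).flatten).reverse = (replicate n L.reverse).flatten := by
  induction n with
  | zero => simp
  | succ n ih =>
    rw [replicate_succ, flatten_cons, reverse_append, ih, replicate_succ', flatten_concat]

/-- Mapping a power word letterwise. [cite: LyndonSchupp2001, Ch. I §2] -/
theorem map_flatten_replicate {β γ : Type*} (f : β → γ) (L : List β) (n : ℕ) :
    ((replicate n L).flatten).map f = (replicate n (L.map f)).flatten := by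
  rw [map_flatten, map_replicate]

/-- The group element of a power word. [cite: LyndonSchupp2001, Ch. I §2] -/
theorem mk_flatten_replicate (L : List (α × Bool)) (n : ℕ) :
    FreeGroup.mk (replicate n L).flatten = FreeGroup.mk L ^ n := by
  induction n with
  | zero => rfl
  | succ n ih => rw [replicate_succ, flatten_cons, ← FreeGroup.mul_mk, ih, pow_succ']

/-- Length of a power word. [cite: LyndonSchupp2001, Ch. I §2] -/
theorem length_flatten_replicate' {β : Type*} (L : List β) (n : ℕ) :
    ((replicate n L).flatten).length = n * L.length := by
  induction n with
  | zero => simp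
  | succ n ih => rw [replicate_succ, flatten_cons, length_append, ih, Nat.succ_mul, Nat.add_comm]

/-- Splitting a power word after `q` periods. [cite: LyndonSchupp2001, Ch. I §2] -/
theorem flatten_replicate_add {β : Type*} (L : List β) (q m : ℕ) :
    (replicate (q + m) L).flatten = (replicate q L).flatten ++ (replicate m L).flatten := by
  rw [replicate_add, flatten_append]

/-- Dropping whole periods from a power word. [cite: LyndonSchupp2001, Ch. I §2] -/
theorem drop_mul_flatten_replicate {β : Type*} (L : List β) (a q : ℕ) (hq : q ≤ a) :
    ((replicate a L).flatten).drop (q * L.length) = (replicate (a - q) L).flatten := by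
  obtain ⟨m, rfl⟩ : ∃ m, a = q + m := ⟨a - q, by omega⟩
  rw [flatten_replicate_add, drop_append_of_le_length (by rw [length_flatten_replicate'])]
  rw [drop_of_length_le (by rw [length_flatten_replicate']), nil_append, Nat.add_sub_cancel_left]

/-- Taking whole periods from a power word. [cite: LyndonSchupp2001, Ch. I §2] -/
theorem take_mul_flatten_replicate {β : Type*} (L : List β) (a q : ℕ) (hq : q ≤ a) :
    ((replicate a L).flatten).take (q * L.length) = (replicate q L).flatten := by
  obtain ⟨m, rfl⟩ : ∃ m, a = q + m := ⟨a - q, by omega⟩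
  rw [flatten_replicate_add, take_append_of_le_length (by rw [length_flatten_replicate']),
    take_of_length_le (by rw [length_flatten_replicate'])]

/-- A prefix of a power word: `q` whole periods and then the first `r` letters of the period.
[cite: LyndonSchupp2001, Ch. I §2] -/
theorem take_flatten_replicate {β : Type*} (L : List β) (a q r : ℕ) (hq : q < a)
    (hr : r ≤ L.length) :
    ((replicate a L).flatten).take (q * L.length + r) = (replicate q L).flatten ++ L.take r := by
  obtain ⟨m, rfl⟩ : ∃ m, a = q + (m + 1) := ⟨a - q - 1, by omega⟩
  rw [flatten_replicate_add, take_append, length_flatten_replicate',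
    take_of_length_le (by rw [length_flatten_replicate']; omega), Nat.add_sub_cancel_left,
    replicate_succ, flatten_cons, take_append_of_le_length hr]

/-- A window of one period length in a power word is a rotation of the period. [cite: LyndonSchupp2001, Ch. I §2] -/
theorem take_drop_flatten_replicate {β : Type*} (L : List β) (a n : ℕ)
    (h : n + L.length ≤ a * L.length) :
    (((replicate a L).flatten).drop n).take L.length = L.rotate (n % L.length) := by
  rcases Nat.eq_zero_or_pos L.length with h0 | hpos
  · rw [length_eq_zero_iff.mp h0]; simp
  -- `n = q ℓ + r`
  set ℓ := L.length with hℓ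
  obtain ⟨q, r, hr, rfl⟩ : ∃ q r, r < ℓ ∧ n = q * ℓ + r :=
    ⟨n / ℓ, n % ℓ, Nat.mod_lt _ hpos, by rw [Nat.mul_comm]; exact (Nat.div_add_mod n ℓ).symm⟩
  have hq : q + 1 ≤ a := by
    by_contra hlt
    push Not at hlt
    have : a * ℓ ≤ q * ℓ := Nat.mul_le_mul_right _ (by omega)
    omega
  have hmod : (q * ℓ + r) % ℓ = r := by
    rw [Nat.mul_comm, Nat.mul_add_mod, Nat.mod_eq_of_lt hr]
  rw [hmod, ← drop_drop, drop_mul_flatten_replicate L a q (by omega)]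
  obtain ⟨m, hm⟩ : ∃ m, a - q = m + 1 := ⟨a - q - 1, by omega⟩
  rw [hm, replicate_succ, flatten_cons, drop_append_of_le_length hr.le, take_append,
    length_drop, take_of_length_le (by rw [length_drop]; omega), rotate_eq_drop_append_take hr.le,
    show ℓ - (ℓ - r) = r by omega]
  congr 1
  -- the first `r` letters of the remaining periods
  rcases m with _ | m
  · -- then `r = 0`
    have hr0 : r = 0 := by
      have h' : (q + 1) * ℓ + r ≤ a * ℓ := by rw [Nat.succ_mul]; omega
      have : a * ℓ ≤ (q + 1) * ℓ := Nat.mul_le_mul_right _ (by omega)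
      omega
    subst hr0; simp
  · rw [replicate_succ, flatten_cons, take_append_of_le_length hr.le]


/-! ### Group-level facts -/

/-- A rotation of a word represents the conjugate of the word by its prefix. [cite: LyndonSchupp2001, Ch. I §2] -/
theorem mk_rotate (L : List (α × Bool)) {s : ℕ} (hs : s ≤ L.length) :
    FreeGroup.mk (L.rotate s) =
      (FreeGroup.mk (L.take s))⁻¹ * FreeGroup.mk L * FreeGroup.mk (L.take s) := by
  have hL : FreeGroup.mk L = FreeGroup.mk (L.take s) * FreeGroup.mk (L.drop s) := by
    rw [FreeGroup.mul_mk, take_append_drop]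
  rw [rotate_eq_drop_append_take hs, ← FreeGroup.mul_mk, hL]
  group

/-- In a free group no element other than `1` is conjugate to its own inverse (torsion-freeness of
`F`: `(xp)² = p²` forces `xp = p`). [cite: LyndonSchupp2001, Ch. I Prop. 2.15] -/
theorem eq_one_of_conj_eq_inv {x p : FreeGroup α} (h : p⁻¹ * x * p = x⁻¹) : x = 1 := by
  have hxp : x * p = p * x⁻¹ := by
    calc x * p = p * (p⁻¹ * x * p) := by group
      _ = p * x⁻¹ := by rw [h]
  have h2 : (x * p) ^ 2 = p ^ 2 := by
    calc (x * p) ^ 2 = (x * p) * (x * p) := sq _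
      _ = (p * x⁻¹) * (x * p) := by nth_rw 1 [hxp]
      _ = p ^ 2 := by rw [sq]; group
  have h3 : x * p = p := (pow_left_inj two_ne_zero).mp h2
  exact mul_right_cancel (h3.trans (one_mul p).symm)

/-- If a rotation of a word equals the word, the corresponding prefix commutes with it. [cite: LyndonSchupp2001, Ch. I §2] -/
theorem commute_mk_take_of_rotate_eq {L : List (α × Bool)} {s : ℕ} (hs : s ≤ L.length)
    (h : L.rotate s = L) : Commute (FreeGroup.mk (L.take s)) (FreeGroup.mk L) := by
  have e := mk_rotate L hs
  rw [h] at e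
  -- `mk L = q⁻¹ (mk L) q`
  change FreeGroup.mk (L.take s) * FreeGroup.mk L = FreeGroup.mk L * FreeGroup.mk (L.take s)
  calc FreeGroup.mk (L.take s) * FreeGroup.mk L
        = FreeGroup.mk (L.take s) *
            ((FreeGroup.mk (L.take s))⁻¹ * FreeGroup.mk L * FreeGroup.mk (L.take s)) := by rw [← e]
    _ = FreeGroup.mk L * FreeGroup.mk (L.take s) := by group

section Reduced

variable [DecidableEq α]

/-- Powers of an element whose word is cyclically reduced are spelled by the power word.
[cite: LyndonSchupp2001, Ch. I §2] -/
theorem toWord_pow_of_isCyclicallyReduced {x : FreeGroup α}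
    (h : FreeGroup.IsCyclicallyReduced x.toWord) (n : ℕ) :
    (x ^ n).toWord = (replicate n x.toWord).flatten := by
  rw [FreeGroup.toWord_pow, (h.flatten_replicate n).isReduced.reduce_eq]

/-- `invRev` preserves cyclic reducedness. [cite: LyndonSchupp2001, Ch. I §2] -/
theorem isCyclicallyReduced_invRev {L : List (α × Bool)} (h : FreeGroup.IsCyclicallyReduced L) :
    FreeGroup.IsCyclicallyReduced (FreeGroup.invRev L) := by
  refine ⟨?_, ?_⟩
  · have e : FreeGroup.invRev L = (FreeGroup.mk L)⁻¹.toWord := by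
      rw [FreeGroup.toWord_inv, FreeGroup.toWord_mk, h.isReduced.reduce_eq]
    rw [e]
    exact FreeGroup.isReduced_toWord
  · intro a ha b hb hab
    simp only [FreeGroup.invRev, getLast?_reverse, head?_reverse, head?_map, getLast?_map,
      Option.mem_def, Option.map_eq_some_iff] at ha hb
    obtain ⟨a', ha', rfl⟩ := ha
    obtain ⟨b', hb', rfl⟩ := hb
    have e : b'.2 = a'.2 := h.2 b' hb' a' ha' (by simpa using hab.symm)
    simp [e]

/-- Powers of the inverse. [cite: LyndonSchupp2001, Ch. I §2] -/
theorem toWord_inv_pow_of_isCyclicallyReduced {x : FreeGroup α}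
    (h : FreeGroup.IsCyclicallyReduced x.toWord) (n : ℕ) :
    (x⁻¹ ^ n).toWord = (replicate n (FreeGroup.invRev x.toWord)).flatten := by
  have h' : FreeGroup.IsCyclicallyReduced x⁻¹.toWord := by
    rw [FreeGroup.toWord_inv]; exact isCyclicallyReduced_invRev h
  rw [toWord_pow_of_isCyclicallyReduced h', FreeGroup.toWord_inv]

/-- If `L₁ ++ L₂` is already reduced, nothing cancels between `L₁` and `L₂`. [cite: LyndonSchupp2001, Ch. I §2] -/
theorem maxCancel_eq_zero_of_isReduced_append {L₁ L₂ : List (α × Bool)}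
    (h : FreeGroup.IsReduced (L₁ ++ L₂)) : maxCancel L₁ L₂ = 0 := by
  have h₁ : FreeGroup.IsReduced L₁ := h.infix ⟨[], L₂, by simp⟩
  have h₂ : FreeGroup.IsReduced L₂ := h.infix ⟨L₁, [], by simp⟩
  have e := reduce_append_eq L₁ L₂ h₁ h₂
  rw [h.reduce_eq] at e
  have hl := congrArg List.length e
  rw [length_append, length_append, length_take, length_drop] at hl
  have k₁ := maxCancel_le_length_left L₁ L₂
  have k₂ := maxCancel_le_length_right L₁ L₂
  omega

end Reduced

/-! ### Left and right stabilisation (Baumslag's cancellation bound) -/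

section Stabilisation

variable [DecidableEq α] {v : FreeGroup α}

/-- For `v` with cyclically reduced word `V`, the word `V ++ V` is reduced. [cite: LyndonSchupp2001, Ch. I §2] -/
theorem isReduced_toWord_append_self (hv : FreeGroup.IsCyclicallyReduced v.toWord) :
    FreeGroup.IsReduced (v.toWord ++ v.toWord) := by
  have h := (hv.flatten_replicate 2).isReduced
  simpa using h

/-- No cancellation between `V` and a word beginning with a full copy of `V`. [cite: LyndonSchupp2001, Ch. I §2] -/
theorem maxCancel_eq_zero_of_prefix (hv : FreeGroup.IsCyclicallyReduced v.toWord) (hv1 : v ≠ 1)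
    (W : List (α × Bool)) : maxCancel v.toWord (v.toWord ++ W) = 0 := by
  have h0 : maxCancel v.toWord v.toWord = 0 :=
    maxCancel_eq_zero_of_isReduced_append (isReduced_toWord_append_self hv)
  have hpos : 0 < v.toWord.length := by
    rw [length_pos_iff]
    exact fun h => hv1 (FreeGroup.toWord_eq_nil_iff.mp h)
  unfold maxCancel at h0 ⊢
  rw [cancelAux_append_right_of_lt _ _ _ (by rw [h0]; exact hpos)]
  exact h0

/-- No cancellation between `V` and a nonempty word beginning with the first LETTER of `V`.
[cite: LyndonSchupp2001, Ch. I §2] -/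
theorem maxCancel_eq_zero_of_head (hv : FreeGroup.IsCyclicallyReduced v.toWord)
    {W : List (α × Bool)} {x : α × Bool} (hx : v.toWord.head? = some x) (hW : W.head? = some x) :
    maxCancel v.toWord W = 0 := by
  obtain ⟨W', rfl⟩ : ∃ W', W = x :: W' := by
    cases W with
    | nil => simp at hW
    | cons y W' => simp only [head?_cons, Option.some.injEq] at hW; exact ⟨W', by rw [hW]⟩
  obtain ⟨y, R, hR⟩ : ∃ y R, v.toWord.reverse = y :: R := by
    cases h : v.toWord.reverse with
    | nil => rw [reverse_eq_nil_iff] at h; rw [h] at hx; simp at hx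
    | cons y R => exact ⟨y, R, rfl⟩
  have hy : v.toWord.getLast? = some y := by
    rw [← head?_reverse, hR]; rfl
  unfold maxCancel
  rw [hR, cancelAux_cons_cons_of_not_cancels]
  rw [not_cancels_iff]
  exact hv.2 y (by rw [Option.mem_def, hy]) x (by rw [Option.mem_def, hx])

/-- **Pumping on the left**: if `h.toWord` begins with a full copy of `V`, then
`(vⁿ h).toWord = Vⁿ ++ h.toWord`. [cite: LyndonSchupp2001, Ch. I §2] -/
theorem toWord_pow_mul_of_prefix (hv : FreeGroup.IsCyclicallyReduced v.toWord) (hv1 : v ≠ 1)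
    {h : FreeGroup α} {W : List (α × Bool)} (hW : h.toWord = v.toWord ++ W) (n : ℕ) :
    (v ^ n * h).toWord = (replicate n v.toWord).flatten ++ h.toWord := by
  induction n with
  | zero => simp
  | succ n ih =>
    have hk : maxCancel v.toWord ((replicate n v.toWord).flatten ++ h.toWord) = 0 := by
      cases n with
      | zero => simpa [hW] using maxCancel_eq_zero_of_prefix hv hv1 W
      | succ n =>
        rw [replicate_succ, flatten_cons, append_assoc]
        exact maxCancel_eq_zero_of_prefix hv hv1 _
    rw [pow_succ', mul_assoc, toWord_mul_eq, ih, hk, Nat.sub_zero, take_length, drop_zero,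
      replicate_succ, flatten_cons, append_assoc]

/-- **Left absorption is bounded**: some power `vᵃ h` is spelled by a word beginning with a full
copy of `V` (the cancellation of `h` against the powers of `v` is eventually exhausted).
[cite: LyndonSchupp2001, Ch. I §2] -/
theorem exists_pow_mul_toWord_eq_append (hv : FreeGroup.IsCyclicallyReduced v.toWord)
    (hv1 : v ≠ 1) (h : FreeGroup α) :
    ∃ (a : ℕ) (W : List (α × Bool)), (v ^ a * h).toWord = v.toWord ++ W := by
  -- strong induction on the length of `h.toWord`
  suffices H : ∀ (n : ℕ) (h : FreeGroup α), h.toWord.length ≤ n →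
      ∃ (a : ℕ) (W : List (α × Bool)), (v ^ a * h).toWord = v.toWord ++ W from
    H _ h le_rfl
  intro n
  induction n with
  | zero =>
    intro h hh
    have h1 : h = 1 := FreeGroup.toWord_eq_nil_iff.mp (length_eq_zero_iff.mp (Nat.le_zero.mp hh))
    exact ⟨1, [], by rw [h1, mul_one, pow_one, append_nil]⟩
  | succ n ih =>
    intro h hh
    have hℓ : 0 < v.toWord.length := by
      rw [length_pos_iff]; exact fun e => hv1 (FreeGroup.toWord_eq_nil_iff.mp e)
    set k := maxCancel v.toWord h.toWord with hkdef
    have hk₁ := maxCancel_le_length_left v.toWord h.toWord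
    have hvh : (v * h).toWord = v.toWord.take (v.toWord.length - k) ++ h.toWord.drop k :=
      toWord_mul_eq v h
    by_cases hk : k < v.toWord.length
    · -- the next copy of `V` does not cancel at all: `(v h).toWord` begins with the head of `V`
      obtain ⟨x, hx⟩ : ∃ x, v.toWord.head? = some x := by
        cases hV : v.toWord with
        | nil => rw [hV] at hℓ; simp at hℓ
        | cons x _ => exact ⟨x, rfl⟩
      have hhead : (v * h).toWord.head? = some x := by
        rw [hvh, head?_append, head?_take, if_neg (by omega), hx, Option.some_or]
      have hk0 : maxCancel v.toWord (v * h).toWord = 0 := maxCancel_eq_zero_of_head hv hx hhead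
      refine ⟨2, (v * h).toWord, ?_⟩
      rw [pow_two, mul_assoc, toWord_mul_eq, hk0, Nat.sub_zero, take_length, drop_zero]
    · -- full absorption: `(v h).toWord` is shorter; induct
      have hk' : k = v.toWord.length := le_antisymm hk₁ (not_lt.mp hk)
      have hlen : (v * h).toWord.length ≤ n := by
        rw [hvh, hk', Nat.sub_self, take_zero, nil_append, length_drop]
        have := maxCancel_le_length_right v.toWord h.toWord
        omega
      obtain ⟨a, W, haW⟩ := ih (v * h) hlen
      exact ⟨a + 1, W, by rw [pow_succ, mul_assoc, haW]⟩

/-- **Left stabilisation (Lemma A)**: beyond some exponent `a`, each further factor `v` on the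
left just prepends a copy of `V` to the word. [cite: LyndonSchupp2001, Ch. I §2] -/
theorem exists_left_stable (hv : FreeGroup.IsCyclicallyReduced v.toWord) (hv1 : v ≠ 1)
    (h : FreeGroup α) :
    ∃ a : ℕ, (∃ W, (v ^ a * h).toWord = v.toWord ++ W) ∧
      ∀ n, (v ^ (n + a) * h).toWord = (replicate n v.toWord).flatten ++ (v ^ a * h).toWord := by
  obtain ⟨a, W, hW⟩ := exists_pow_mul_toWord_eq_append hv hv1 h
  refine ⟨a, ⟨W, hW⟩, fun n => ?_⟩
  rw [pow_add, mul_assoc]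
  exact toWord_pow_mul_of_prefix hv hv1 hW n

/-- **Right stabilisation (Lemma A')**, by inversion from the left version for `v⁻¹`.
[cite: LyndonSchupp2001, Ch. I §2] -/
theorem exists_right_stable (hv : FreeGroup.IsCyclicallyReduced v.toWord) (hv1 : v ≠ 1)
    (h : FreeGroup α) :
    ∃ b : ℕ, (∃ W, (h * v ^ b).toWord = W ++ v.toWord) ∧
      ∀ n, (h * v ^ (b + n)).toWord = (h * v ^ b).toWord ++ (replicate n v.toWord).flatten := by
  have hv' : FreeGroup.IsCyclicallyReduced v⁻¹.toWord := by
    rw [FreeGroup.toWord_inv]; exact isCyclicallyReduced_invRev hv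
  have hv1' : v⁻¹ ≠ 1 := inv_ne_one.mpr hv1
  obtain ⟨a, ⟨W, hW⟩, hall⟩ := exists_left_stable hv' hv1' h⁻¹
  have hinv : ∀ m : ℕ, h * v ^ m = (v⁻¹ ^ m * h⁻¹)⁻¹ := fun m => by
    rw [mul_inv_rev, inv_inv, inv_pow, inv_inv]
  refine ⟨a, ⟨FreeGroup.invRev W, ?_⟩, fun n => ?_⟩
  · rw [hinv, FreeGroup.toWord_inv, hW, FreeGroup.invRev_append, ← FreeGroup.toWord_inv, inv_inv]
  · rw [hinv (a + n), FreeGroup.toWord_inv, Nat.add_comm, hall n, FreeGroup.invRev_append,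
      invRev_flatten_replicate, ← FreeGroup.toWord_inv, ← FreeGroup.toWord_inv, inv_inv, ← hinv]

end Stabilisation

end FreeGroupBigPowers

end Literature.GroupTheory.CombinatorialGroupTheory
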